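import Summits.BirchSwinnertonDyer.BirchSwinnertonDyer.Theorems.ResidualThetaTransportAtTwoAwayDefs
import Summits.BirchSwinnertonDyer.BirchSwinnertonDyer.Theorems.ResidualThetaTransportAtTwoResidualSignedLambdaLowerCMAtTwoProfiniteOneCocycleExtension
import Literature.NumberTheory.GaloisRepresentations.AbsGaloisGroupCompact
import Literature.NumberTheory.EllipticCurves.CofreeTorsionFiniteness
import Literature.NumberTheory.EllipticCurves.ZpExtensionPadicUnitsProofs
import HarnessLib

/-!
# EXHAUSTION of `D_w = H¹(ℚ_{∞,w̃}, A_ρ)` by the images `jAway w n k : H¹(U_{n,w}, A_ρ[2^k]) → D_w`, and uniqueness of additive maps on `D_w`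
# pinned on those images — the AwayTwo frame's «one link not in the tree»

Route `ResidualThetaTransportAtTwo` (RTT), crux RSL_g `ResidualSignedLambdaLowerCMAtTwo` (stmt-BirchSwinnertonDyer-22608), line «onepair»; seat
`prover-bsd-wall-tp2-p2x-w2` g19 (`--supports`, closes nothing). THEOREMS ONLY (no definition, no named fact, no instance, no `sorry`). BSD is not
proved by any of this; RSL_g (22608) stays OPEN.

WHY. The S₀-side frame `Theorems/ResidualThetaTransportAtTwoAwayDefs.lean` (rtt-p2 LEAD g18) pins the Pontryagin-valued localisation
`AwayPins.locdS x w c : CharacterModule (Dloc w)` only on the images of `jAway w m k` for `m ≥ nfl w` (`AwayPins.hlocdS`). Every use of that pin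
downstream — uniqueness of `locdS`, the `S₀`-pin transfer of S4₂ (STUB-PLAN rev 22 S95 (4)(5): «`⟨conj proj x, ·⟩ = 0` levelwise ⟹ `locdS x = 0`»),
the gluing that CONSTRUCTS `locdS` — needs: **every `y : Dloc w` is `jAway w n k y'` for some `n ≥ nfl w` and some `k`** (critic Q93). This file
proves exactly that, by composing
* the coefficient half (Serre I §2.2 Prop. 8 for `A_ρ = ⋃ₖ A_ρ[2^k]`): a continuous cocycle on the compact `U_{∞,w}` with values in the discrete
  `2`-primary `A_ρ` takes finitely many values, hence lands in one `A_ρ[2^k]` (`exists_cohomologyMap_torsionLocalInclusion_eq`), and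
* the subgroup half `H¹(⋂ₙ U_{n,w}, ·) = ⋃ₙ res H¹(U_{n,w}, ·)` = `ProfiniteExhaustion.exists_resLe_eq_of_iInf_from` (p698914), transported
  along `U_{∞,w} = ⋂ₙ U_{n,w}` (`kerGroup_eq_iInf_layerGroup`, from the tree's `iInf_layerSubgroup_eq_ker`).

* **`exists_jAway_eq`** / **`exists_jAway_eq_from`**: `∀ y : Dloc S κ ρ w, ∃ n ≥ nfl w, ∃ k y', jAway S κ ρ w n k y' = y`.
* **`addMonoidHom_eq_of_jAway`**: two additive maps `Dloc S κ ρ w →+ Z` agreeing on every `jAway w n k y'` (`n ≥ nfl w`) are equal; element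
  form **`eq_of_jAway`**; in particular (`characterModule_eq_zero_of_jAway`) a character of `Dloc w` vanishing on those images is `0` — the shape
  in which `AwayPins.hlocdS` + levelwise orthogonality give `π.locdS x w c = 0`.

References: [SerreGaloisCohomology1997] I §2.2 Prop. 8; [Shatz1972] Ch. II §2; [Washington1997] §13.1 (`Γ_∞ = ⋂ Γ_n`);
[GreenbergVatsal2000] §2 Prop. 2.4 (the module `H¹(ℚ_{∞,η}, A)` at `η ∤ p`).
-/

set_option autoImplicit false
-- the Theorems namespace of this sub repeats the summit name by design (D-0017 nested layout)
set_option linter.dupNamespace false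

noncomputable section

open CategoryTheory Topology Field NumberField IsDedekindDomain
open Literature.NumberTheory.GaloisRepresentations Literature.NumberTheory.EllipticCurves
open Literature.NumberTheory.EllipticCurves.GreenbergSelmer Literature.NumberTheory.EllipticCurves.CyclotomicLayer

namespace Summit.BirchSwinnertonDyer.BirchSwinnertonDyer.Theorems.ThetaTransport.ProfiniteExhaustion

universe u v

/-! ## §1 Generic: transport of the subgroup half along an equality `T = ⨅ₖ Sₖ` -/

section Generic

variable {R : Type u} [Ring R] [TopologicalSpace R]
  {G : Type v} [Group G] [TopologicalSpace G] [IsTopologicalGroup G] [CompactSpace G] [TotallyDisconnectedSpace G]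
  (X : TopRep.{v} R G) [DiscreteTopology X]

/-- **`H¹(T, X) = ⋃_{k ≥ n₀} res H¹(Sₖ, X)` for a closed subgroup `T` that EQUALS `⨅ₖ Sₖ`** (the form in which `exists_resLe_eq_of_iInf_from`
is applied to a subgroup given by its own name, e.g. `kerGroup κ w`). [cite: SerreGaloisCohomology1997, I §2.2 Prop. 8] -/
theorem exists_resLe_eq_of_eq_iInf_from (hX : ∀ a : X, Continuous fun g : G ↦ X.ρ g a)
    (S : ℕ → Subgroup G) (hS : Antitone S) (hcl : ∀ k, IsClosed ((S k : Subgroup G) : Set G))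
    {T : Subgroup G} (hT : T = ⨅ k, S k) (hle : ∀ k, T ≤ S k) (n₀ : ℕ)
    (y : continuousCohomology 1 (subgroupRep X T)) :
    ∃ k : ℕ, n₀ ≤ k ∧ ∃ y' : continuousCohomology 1 (subgroupRep X (S k)), resLe X (hle k) 1 y' = y := by
  subst hT
  obtain ⟨k, hk, y', hy'⟩ := exists_resLe_eq_of_iInf_from X hX S hS hcl n₀ y
  exact ⟨k, hk, y', hy'⟩

end Generic

/-! ## §2 The local tower at `w`: `U_{∞,w} = ⋂ₙ U_{n,w}`, closedness, compactness -/

section Tower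

variable {p : ℕ} [Fact p.Prime] (κ : ZpExtension ℚ p) (w : HeightOneSpectrum (𝓞 ℚ))

/-- **`U_{∞,w} = ⋂ₙ U_{n,w}`** (`Γ_∞ = ⋂ₙ Γₙ`: an element of `ℤ_p` divisible by every `pⁿ` is `0`, pulled back along `Γ_{ℚ_w} → Γ_ℚ`).
[cite: Washington1997, §13.1] -/
-- proof adapted from the tree's `Literature.NumberTheory.GaloisRepresentations.iInf_layerSubgroup_eq_ker` (NumberFieldCdTwoProofs), kept
-- import-light for the frame's consumers
theorem kerGroup_eq_iInf_layerGroup : kerGroup κ w = ⨅ n, layerGroup κ w n := by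
  refine le_antisymm (le_iInf fun n ↦ kerGroup_le_layerGroup κ w n) fun τ hτ ↦ ?_
  rw [Subgroup.mem_iInf] at hτ
  change resGalOfEmb (closureEmb (K := ℚ) (w.adicCompletion ℚ)) τ ∈ κ.kerSubgroup
  rw [ZpExtension.mem_kerSubgroup]
  have h0 : (κ (resGalOfEmb (closureEmb (K := ℚ) (w.adicCompletion ℚ)) τ)).toAdd = 0 :=
    ZpExtension.PadicUnits.eq_zero_of_forall_pow_dvd fun n ↦ ZpExtension.mem_layerSubgroup.mp (hτ n)
  exact toAdd_eq_zero.mp h0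

/-- `n ↦ U_{n,w}` is antitone. [cite: Washington1997, §13.1] -/
theorem antitone_layerGroup : Antitone (layerGroup κ w) := fun _ _ h ↦ Subgroup.comap_mono (κ.layerSubgroup_antitone h)

/-- Each `U_{n,w}` is closed (it is open). [cite: SerreGaloisCohomology1997, I §1.1] -/
theorem isClosed_layerGroup (n : ℕ) : IsClosed ((layerGroup κ w n : Subgroup _) : Set (absoluteGaloisGroup (w.adicCompletion ℚ))) :=
  (layerGroup κ w n).isClosed_of_isOpen (isOpen_layerGroup κ w n)

/-- `U_{∞,w}` is closed. [cite: SerreGaloisCohomology1997, I §1.1] -/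
theorem isClosed_kerGroup : IsClosed ((kerGroup κ w : Subgroup _) : Set (absoluteGaloisGroup (w.adicCompletion ℚ))) := by
  rw [kerGroup_eq_iInf_layerGroup, Subgroup.coe_iInf]
  exact isClosed_iInter (isClosed_layerGroup κ w)

end Tower

/-! ## §3 The coefficient half: a class of `H¹(U_{∞,w}, A_ρ)` comes from some `A_ρ[2^k]` -/

section Coefficients

variable {p : ℕ} [Fact p.Prime] (S : Set (PadicAlgCl p)) (κ : ZpExtension ℚ p) {r : ℕ}
  (ρ : FramedGaloisRep ℚ ↥(padicCoeffIntegers S) r) (w : HeightOneSpectrum (𝓞 ℚ))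

/-- **`K = 𝒪[1/p]`** for `K = ℚ_p(S)`, `𝒪 = {x ∈ K : ‖x‖ ≤ 1}`: every `x ∈ K` has `p^j x ∈ 𝒪` for some `j` (take `p^j ≥ ‖x‖`; twin of the
tree's `exists_pow_p_mul_mem_padicCoeffIntegers` for the newform-indexed coefficient rings). [cite: EmertonPollackWeston2006, §3.1 (arXiv:math/0404484 p. 17)] -/
theorem exists_pow_mul_eq_algebraMap_padicCoeffIntegers (x : padicCoeffField S) :
    ∃ (j : ℕ) (y : padicCoeffIntegers S), algebraMap (padicCoeffIntegers S) (padicCoeffField S) y = (p : padicCoeffField S) ^ j * x := by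
  have hp0 : (0 : ℝ) < p := by exact_mod_cast (Fact.out : p.Prime).pos
  have hp1 : (1 : ℝ) < p := by exact_mod_cast (Fact.out : p.Prime).one_lt
  have hnp : ‖(p : PadicAlgCl p)‖ = (p : ℝ)⁻¹ := by
    have h := PadicAlgCl.valuation_p p
    rw [PadicAlgCl.valuation_def] at h
    have : (‖(p : PadicAlgCl p)‖₊ : ℝ) = ((1 / (p : NNReal) : NNReal) : ℝ) := by rw [h]
    simpa using this
  obtain ⟨j, hj⟩ := pow_unbounded_of_one_lt ‖(x : PadicAlgCl p)‖ hp1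
  have hy : (((p : padicCoeffField S) ^ j * x : padicCoeffField S) : PadicAlgCl p) ∈ padicCoeffIntegers S := by
    refine ⟨((p : padicCoeffField S) ^ j * x).2, ?_⟩
    push_cast
    rw [norm_mul, norm_pow, hnp, inv_pow, inv_mul_le_iff₀ (pow_pos hp0 j), mul_one]
    exact hj.le
  exact ⟨j, ⟨_, hy⟩, rfl⟩

/-- **`A_ρ = Kʳ/𝒪ʳ` is `p`-primary**: every `a ∈ A_ρ` is killed by some `p^j`. [cite: Greenberg1989, §1 p. 98] -/
theorem exists_pow_smul_cofree_eq_zero (a : Cofree ρ ↥(padicCoeffField S)) : ∃ j : ℕ, p ^ j • a = 0 :=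
  Cofree.exists_pow_nsmul_eq_zero ρ p (exists_pow_mul_eq_algebraMap_padicCoeffIntegers S) a

/-- **A continuous cocycle of a COMPACT subgroup `H ≤ Γ_{ℚ_w}` with values in `A_ρ` is valued in one `A_ρ[p^k]`, hence its class is in the image
of `H¹(H, A_ρ[p^k]) → H¹(H, A_ρ)`** (`A_ρ` discrete and `p`-primary: finitely many values, a common exponent).
[cite: SerreGaloisCohomology1997, I §2.2 Prop. 8] [cite: Greenberg1989, §1 p. 98] -/
theorem exists_cohomologyMap_torsionLocalInclusion_eq (H : Subgroup (absoluteGaloisGroup (w.adicCompletion ℚ))) [CompactSpace H]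
    (y : continuousCohomology 1 (subgroupRep (localRepOf (cofreeGaloisModule S ρ) w) H)) :
    ∃ (k : ℕ) (y₁ : continuousCohomology 1 (subgroupRep (localRepOf (cofreeTorsionGaloisModule S ρ ((p ^ k : ℕ) : ℤ)) w) H)),
      cohomologyMap (subgroupRepMap (Y := localRepOf (cofreeGaloisModule S ρ) w)
        (cofreeTorsionLocalInclusion S ρ ((p ^ k : ℕ) : ℤ) w) H) 1 y₁ = y := by
  obtain ⟨φ, rfl⟩ := oneCocycleClass_surjective _ y
  -- finitely many values, one exponent
  have hfin : (Set.range φ.1).Finite := (isCompact_range φ.1.continuous).finite_of_discrete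
  choose j hj using exists_pow_smul_cofree_eq_zero S ρ
  obtain ⟨k, hk⟩ : ∃ k : ℕ, ∀ a ∈ hfin.toFinset, j a ≤ k := ⟨hfin.toFinset.sup j, fun a ha ↦ Finset.le_sup ha⟩
  have hmem : ∀ g : H, (φ.1 g : Cofree ρ ↥(padicCoeffField S)) ∈
      AddSubgroup.torsionBy (Cofree ρ ↥(padicCoeffField S)) ((p ^ k : ℕ) : ℤ) := fun g ↦ by
    have hle : j (φ.1 g) ≤ k := hk _ (hfin.mem_toFinset.2 ⟨g, rfl⟩)
    obtain ⟨d, hd⟩ := Nat.exists_eq_add_of_le hle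
    have h0 : ((p ^ k : ℕ) : ℤ) • (φ.1 g : Cofree ρ ↥(padicCoeffField S)) = 0 := by
      rw [natCast_zsmul, hd, pow_add, mul_comm, mul_smul, hj, smul_zero]
    exact (Submodule.mem_torsionBy_iff (R := ℤ) _ _).2 h0
  -- the lifted cocycle
  let ψ : contOneCocycles (subgroupRep (localRepOf (cofreeTorsionGaloisModule S ρ ((p ^ k : ℕ) : ℤ)) w) H) :=
    ⟨⟨fun g ↦ ⟨φ.1 g, hmem g⟩, φ.1.continuous.subtype_mk _⟩, fun g h ↦ Subtype.ext (by
      change φ.1 (g * h) = φ.1 g + ((cofreeTorsionLocalInclusion S ρ ((p ^ k : ℕ) : ℤ) w).hom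
        ((localRepOf (cofreeTorsionGaloisModule S ρ ((p ^ k : ℕ) : ℤ)) w).ρ (g : absoluteGaloisGroup (w.adicCompletion ℚ)) ⟨φ.1 h, hmem h⟩))
      rw [TopRep.hom_comm_apply, cofreeTorsionLocalInclusion_apply, φ.2, subgroupRep_ρ_apply])⟩
  refine ⟨k, oneCocycleClass _ ψ, ?_⟩
  rw [cohomologyMap_oneCocycleClass]
  congr 1

end Coefficients

/-! ## §4 Exhaustion of `Dloc` by the `jAway` images; uniqueness of pinned additive maps -/

section Away

variable (S : Set (PadicAlgCl 2)) (κ : ZpExtension ℚ 2) (ρ : FramedGaloisRep ℚ ↥(padicCoeffIntegers S) 2)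
  (w : HeightOneSpectrum (𝓞 ℚ))

/-- **EXHAUSTION from a floor**: every `y ∈ D_w = H¹(ℚ_{∞,w̃}, A_ρ)` is `jAway w n k y'` for some layer `n ≥ n₀`, some level `2^k` and some
`y' ∈ H¹(U_{n,w}, A_ρ[2^k])`. [cite: SerreGaloisCohomology1997, I §2.2 Prop. 8] [cite: GreenbergVatsal2000, §2 Prop. 2.4] -/
theorem exists_jAway_eq_of_le (n₀ : ℕ) (y : OnePair.Dloc S κ ρ w) :
    ∃ n : ℕ, n₀ ≤ n ∧ ∃ (k : ℕ) (y' : OnePair.Dlev S κ ρ w n k), OnePair.jAway S κ ρ w n k y' = y := by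
  haveI : CompactSpace (absoluteGaloisGroup (w.adicCompletion ℚ)) := absoluteGaloisGroup_compactSpace _
  haveI : TotallyDisconnectedSpace (absoluteGaloisGroup (w.adicCompletion ℚ)) := inferInstance
  haveI : CompactSpace (kerGroup κ w) := isCompact_iff_compactSpace.mp (isClosed_kerGroup κ w).isCompact
  obtain ⟨k, y₁, hy₁⟩ := exists_cohomologyMap_torsionLocalInclusion_eq S ρ w (kerGroup κ w) y
  obtain ⟨n, hn, y', hy'⟩ := exists_resLe_eq_of_eq_iInf_from (localRepOf (cofreeTorsionGaloisModule S ρ ((2 ^ k : ℕ) : ℤ)) w)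
    (fun a ↦ (GaloisRep.restrictField (w.adicCompletion ℚ) (cofreeTorsionGaloisModule S ρ ((2 ^ k : ℕ) : ℤ))).continuous_apply_left a)
    (layerGroup κ w) (antitone_layerGroup κ w) (isClosed_layerGroup κ w) (kerGroup_eq_iInf_layerGroup κ w)
    (kerGroup_le_layerGroup κ w) n₀ y₁
  refine ⟨n, hn, k, y', ?_⟩
  rw [← hy₁, ← hy']
  rfl

/-- **EXHAUSTION from the frame's floor `nfl w`** (the layers on which `AwayPins.hlocdS` pins `locdS`): every `y ∈ D_w` is `jAway w n k y'` with
`nfl w ≤ n`. [cite: SerreGaloisCohomology1997, I §2.2 Prop. 8] [cite: GreenbergVatsal2000, §2 Prop. 2.4] -/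
theorem exists_jAway_eq_from (y : OnePair.Dloc S κ ρ w) :
    ∃ n : ℕ, OnePair.nfl w ≤ n ∧ ∃ (k : ℕ) (y' : OnePair.Dlev S κ ρ w n k), OnePair.jAway S κ ρ w n k y' = y :=
  exists_jAway_eq_of_le S κ ρ w (OnePair.nfl w) y

/-- **EXHAUSTION** (no floor): every `y ∈ D_w` is some `jAway w n k y'`. [cite: SerreGaloisCohomology1997, I §2.2 Prop. 8] -/
theorem exists_jAway_eq (y : OnePair.Dloc S κ ρ w) :
    ∃ (n k : ℕ) (y' : OnePair.Dlev S κ ρ w n k), OnePair.jAway S κ ρ w n k y' = y := by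
  obtain ⟨n, -, k, y', h⟩ := exists_jAway_eq_of_le S κ ρ w 0 y
  exact ⟨n, k, y', h⟩

/-- `jAway` is surjective "in the colimit": the union over `n ≥ nfl w`, `k` of the ranges of `jAway w n k` is everything.
[cite: SerreGaloisCohomology1997, I §2.2 Prop. 8] -/
theorem iUnion_range_jAway_eq_univ :
    (⋃ n ∈ Set.Ici (OnePair.nfl w), ⋃ k : ℕ, Set.range (OnePair.jAway S κ ρ w n k)) = Set.univ := by
  refine Set.eq_univ_of_forall fun y ↦ ?_
  obtain ⟨n, hn, k, y', h⟩ := exists_jAway_eq_from S κ ρ w y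
  exact Set.mem_iUnion₂.2 ⟨n, hn, Set.mem_iUnion.2 ⟨k, y', h⟩⟩

/-- **UNIQUENESS of pinned additive maps**: two additive maps out of `D_w` that agree on every `jAway w n k y'` with `n ≥ nfl w` are equal
(so `AwayPins.locdS x w c`, pinned by `hlocdS`, is determined by the pin). [cite: SerreGaloisCohomology1997, I §2.2 Prop. 8] -/
theorem addMonoidHom_eq_of_jAway {Z : Type*} [AddZeroClass Z] (f g : OnePair.Dloc S κ ρ w →+ Z)
    (h : ∀ n, OnePair.nfl w ≤ n → ∀ (k : ℕ) (y' : OnePair.Dlev S κ ρ w n k), f (OnePair.jAway S κ ρ w n k y') = g (OnePair.jAway S κ ρ w n k y')) :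
    f = g := by
  refine AddMonoidHom.ext fun y ↦ ?_
  obtain ⟨n, hn, k, y', rfl⟩ := exists_jAway_eq_from S κ ρ w y
  exact h n hn k y'

/-- Element form of the uniqueness: two FUNCTIONS on `D_w` agreeing on the `jAway` images (`n ≥ nfl w`) agree everywhere.
[cite: SerreGaloisCohomology1997, I §2.2 Prop. 8] -/
theorem eq_of_jAway {Z : Sort*} (f g : OnePair.Dloc S κ ρ w → Z)
    (h : ∀ n, OnePair.nfl w ≤ n → ∀ (k : ℕ) (y' : OnePair.Dlev S κ ρ w n k), f (OnePair.jAway S κ ρ w n k y') = g (OnePair.jAway S κ ρ w n k y'))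
    (y : OnePair.Dloc S κ ρ w) : f y = g y := by
  obtain ⟨n, hn, k, y', rfl⟩ := exists_jAway_eq_from S κ ρ w y
  exact h n hn k y'

/-- **A character of `D_w` vanishing on every `jAway w n k y'` (`n ≥ nfl w`) is zero** — the shape in which the value pin `AwayPins.hlocdS` and
the levelwise orthogonality `⟨red conj proj x, y'⟩ = 0` force `π.locdS x w c = 0` (STUB-PLAN rev 22 S95 (5)).
[cite: SerreGaloisCohomology1997, I §2.2 Prop. 8] [cite: GreenbergVatsal2000, §2 Prop. 2.4] -/
theorem characterModule_eq_zero_of_jAway (χ : CharacterModule (OnePair.Dloc S κ ρ w))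
    (h : ∀ n, OnePair.nfl w ≤ n → ∀ (k : ℕ) (y' : OnePair.Dlev S κ ρ w n k), χ (OnePair.jAway S κ ρ w n k y') = 0) : χ = 0 := by
  refine CharacterModule.ext _ fun y ↦ ?_
  obtain ⟨n, hn, k, y', rfl⟩ := exists_jAway_eq_from S κ ρ w y
  rw [h n hn k y']
  rfl

/-- The same for a whole `P_{S₀}`-valued vector: `P : PAway` with every component vanishing on the pinned images is `0`.
[cite: GreenbergVatsal2000, §2 Prop. 2.4] -/
theorem pAway_eq_zero_of_jAway (S₀ : Finset (HeightOneSpectrum (𝓞 ℚ))) (P : OnePair.PAway S κ ρ S₀)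
    (h : ∀ (w : ↥S₀) (c : OnePair.Cosets κ (w : HeightOneSpectrum (𝓞 ℚ))) (n : ℕ), OnePair.nfl (w : HeightOneSpectrum (𝓞 ℚ)) ≤ n →
      ∀ (k : ℕ) (y' : OnePair.Dlev S κ ρ w n k), P w c (OnePair.jAway S κ ρ w n k y') = 0) : P = 0 :=
  funext fun w ↦ funext fun c ↦ characterModule_eq_zero_of_jAway S κ ρ w (P w c) (h w c)

end Away

end Summit.BirchSwinnertonDyer.BirchSwinnertonDyer.Theorems.ThetaTransport.ProfiniteExhaustion

end
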